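import Literature.MathematicalPhysics.QuantumFieldTheory.Balaban1983to89.B11Eq103H1Complex
import Literature.MathematicalPhysics.QuantumFieldTheory.Balaban1983to89.B9Eq310HessianOperator
import Literature.MathematicalPhysics.QuantumFieldTheory.Balaban1983to89.B9Eq352ScalarFluct

/-!
# `Balaban1983to89.B9Eq323SiteLaplacianJunction` — T. Bałaban, *Propagators for lattice gauge theories in a background field*, Commun. Math. Phys. **99**
# (1985) 389–434 [Balaban1985BackgroundPropagators] (3.3) p. 390, (3.8) p. 392, (3.23) p. 394 «Δ_U = Σ_μ D*_{U,μ}D_{U,μ}», (3.50) p. 400: **THE JUNCTION BETWEEN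
# THE TREE's TWO TYPINGS OF THE COVARIANT SITE LAPLACIAN** — the NE9 chain's `B11Eq103H1Complex.covLaplaceSiteK η⁻¹ (adTransportW φ U) (adTransportW φ U⁻¹)` on
# the `L²` carrier `SiteL2K ℂ d Pd c₀ W` (fibre `W` read in `𝔸` along `φ`) and pv27∕r06's `B9Eq352ScalarFluct.siteLap T U η` on the shift model
# `(S, T μ, U μ x)` AGREE through the dictionary `S := TSite d Pd`, `T μ := shiftEquiv μ`, `U μ x := U (x, μ)`, `λ := φ ∘ f` (the same dictionary as
# leaf-04's `B9Eq310DeltaPrimeJunction` for the Hessian form) — item (j3) of the NE9 lineage memo `ROUTE-J-VIA-THM34-g98.md` (the site-propagator identities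
# `eq353`∕`eq360_op` of the Sect. B programme live on the right-hand model)

statement-level skeleton of published theorems with citation tags; proofs where landed; nothing here is a claim about the Yang–Mills mass gap

CITATION HEADER (lean-in-tree rule).  Audit cell `pub-balaban`, sub-cell `t4`, BINDER row NE9; NE9 crux-team LEAF PROVER 01 (`b2b-balaban-t4-ne9-formalise-leaf-01`,
gen 98; bears_on: R4/N22).  Vocabulary BY NAME: `B11Eq103H1Complex` (`SiteL2K`, `covDerivL2K`, `covDivL2K`, `covLaplaceSiteK`, `equiv_covDerivL2K`,
`equiv_covDivL2K`), `B9Eq33CovDerivVector` (`covDeriv_apply`, `covDiv_apply`, `shiftEquiv`), `B9Eq310HessianOperator.adTransportW_apply`, `B9Eq39Adjoint`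
(`R`, `covD`, `covDstar`), `B9Eq352ScalarFluct.siteLap`.  Source read through those files' verbatim quotations (pp. 390–394, 400).  [folklore] algebra between two
encodings of the same printed operator; nothing of the paper asserted.

WHAT IS PROVED (sorry-free; proof lane — no `def`).
* `phi_adTransportW` (`φ(R_W(U)(b)w) = R(U(b))(φw)`), `phi_adTransportW_inv` (`φ(R_W(U⁻¹)(b)w) = R(U(b))⁻¹… = R(U(b)⁻¹)(φw)`), `shiftEquiv_symm_apply'`.
* `phi_covDerivL2K` — `φ((D^η_U f)(x, μ)) = η⁻¹·covD T U μ (φ∘f) x`; `phi_covDivL2K` — `φ((D^{η*}_U A)(x)) = η⁻¹·Σ_μ covDstar T U μ (φ∘A(·,μ)) x`.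
* **`phi_covLaplaceSiteK_eq_siteLap`** — `φ((Δ^η_U f)(x)) = siteLap T U η (φ∘f) x`: the NE9 chain's covariant site Laplacian IS pv27∕r06's.
HONEST SCOPE.  Definitional bookkeeping; no estimate; NOT the averaging∕penalty junction (`Q′_k(U)` ↔ `kerOp kQ`), NOT the realification `conj b` — later items of
(j2)∕(j3); NE9 NOT PRINTED ∕ NOT PROVED; spine PROVED 0∕9; rung (B)+1 finite T⁴ — NOT infinite volume, NOT mass gap, NOT BetaPertH, NOT Clay.  HONEST DEPENDENCY:
continuum YM on T⁴ ⇐ BetaPertH ∧ nine spine estimates (0/9 proved); BetaPertH ⇐ (D1) ∧ (D4) ∧ CAP+tail; G-an2-4 gates asym, D1 and NE2/3/4.  NEW file; nothing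
modified.  Net new unproved facts: 0.
-/

noncomputable section

open scoped BigOperators

namespace Literature.MathematicalPhysics.QuantumFieldTheory.Balaban1983to89.B9Eq323SiteLaplacianJunction

open B4Sect5Torus (TSite)
open B9SectCLatticeCarrier (Bond shift unshift)
open B9Eq311L2Pairing (WL2)
open B9Eq33CovDerivVector (covDeriv_apply covDiv_apply shiftEquiv adTransport_apply)
open B11Eq103H1Complex (SiteL2K BondL2K covDerivL2K covDivL2K covLaplaceSiteK equiv_covDerivL2K equiv_covDivL2K)
open B9Eq310HessianOperator (adTransportW adTransportW_apply)
open B9Eq39Adjoint (R covD covDstar)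
open B9Eq352ScalarFluct (siteLap)

variable {d : ℕ} {Pd : Fin d → ℕ} {𝔸 : Type*} [NormedRing 𝔸] [NormedAlgebra ℂ 𝔸]
  {W : Type*} [NormedAddCommGroup W] [InnerProductSpace ℂ W] (φ : W ≃ₗ[ℂ] 𝔸) {c₀ : ℝ} [Fact (0 < c₀)]
  (η : ℝ) (U : Bond d Pd → 𝔸ˣ)

/-! ## §1 The dictionary letters -/

omit [Fact (0 < c₀)] in
/-- `φ(R_W(U)(b) w) = R(U(b))(φ w)` — the fibre transport read in `𝔸` is pv27's `R`. [cite: Balaban1985BackgroundPropagators, p.390] -/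
theorem phi_adTransportW (b : Bond d Pd) (w : W) : φ (adTransportW φ U b w) = R (U b) (φ w) := by
  rw [adTransportW_apply, LinearEquiv.apply_symm_apply, R]

omit [Fact (0 < c₀)] in
/-- `φ(R_W(U⁻¹)(b) w) = R(U(b)⁻¹)(φ w)`. [cite: Balaban1985BackgroundPropagators, (3.5) p.391] -/
theorem phi_adTransportW_inv (b : Bond d Pd) (w : W) : φ (adTransportW φ (fun b => (U b)⁻¹) b w) = R (U b)⁻¹ (φ w) := by
  rw [adTransportW_apply, LinearEquiv.apply_symm_apply, R]

/-- `(shiftEquiv μ)⁻¹ x = x − e_μ`. [folklore] [cite: Balaban1985BackgroundPropagators, (3.8) p.392] -/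
theorem shiftEquiv_symm_apply' (μ : Fin d) (x : TSite d Pd) : (shiftEquiv (Pd := Pd) μ).symm x = unshift μ x := rfl

/-! ## §2 `D^η_U`, `D^{η*}_U` and `Δ^η_U` through the dictionary -/

/-- **`φ((D^η_U f)(x, μ)) = η⁻¹·(covD T U μ (φ∘f))(x)`** — (3.3) on the `L²` carrier IS pv27's `covD` at `T μ := shiftEquiv μ`, `U μ x := U(x, μ)`.
[cite: Balaban1985BackgroundPropagators, (3.3) p.390] -/
theorem phi_covDerivL2K (f : SiteL2K ℂ d Pd c₀ W) (x : TSite d Pd) (μ : Fin d) :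
    φ (WL2.equiv ℂ _ W (covDerivL2K ℂ c₀ ((η : ℂ))⁻¹ (adTransportW φ U) f) (x, μ)) =
      ((η : ℂ))⁻¹ • covD (fun μ => shiftEquiv (Pd := Pd) μ) (fun μ y => U (y, μ)) μ (fun y => φ (WL2.equiv ℂ _ W f y)) x := by
  rw [equiv_covDerivL2K, covDeriv_apply, map_smul, map_sub, phi_adTransportW]
  rfl

/-- **`φ((D^{η*}_U A)(x)) = η⁻¹·Σ_μ (covDstar T U μ (φ∘A(·, μ)))(x)`** — (3.8) on the `L²` carrier IS the sum over directions of pv27's `covDstar`.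
[cite: Balaban1985BackgroundPropagators, (3.8) p.392] -/
theorem phi_covDivL2K (A : BondL2K ℂ d Pd c₀ W) (x : TSite d Pd) :
    φ (WL2.equiv ℂ _ W (covDivL2K ℂ c₀ ((η : ℂ))⁻¹ (adTransportW φ fun b => (U b)⁻¹) A) x) =
      ((η : ℂ))⁻¹ • ∑ μ, covDstar (fun μ => shiftEquiv (Pd := Pd) μ) (fun μ y => U (y, μ)) μ (fun y => φ (WL2.equiv ℂ _ W A (y, μ))) x := by
  rw [equiv_covDivL2K, covDiv_apply, map_smul, map_sum]
  congr 1
  refine Finset.sum_congr rfl fun μ _ => ?_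
  rw [map_sub, phi_adTransportW_inv]
  rfl

/-- **THE JUNCTION: `φ((Δ^η_U f)(x)) = siteLap T U η (φ∘f) x`** — the NE9 chain's `covLaplaceSiteK η⁻¹ (R_W(U)) (R_W(U⁻¹)) = D^{η*}_U ∘ D^η_U` ((3.23)) read in `𝔸`
along `φ` IS pv27∕r06's `siteLap` ((3.50)) at the dictionary `T μ := shiftEquiv μ`, `U μ x := U(x, μ)`.
[cite: Balaban1985BackgroundPropagators, (3.23) p.394, (3.50) p.400] -/
theorem phi_covLaplaceSiteK_eq_siteLap (f : SiteL2K ℂ d Pd c₀ W) (x : TSite d Pd) :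
    φ (WL2.equiv ℂ _ W (covLaplaceSiteK ((η : ℂ))⁻¹ (adTransportW φ U) (adTransportW φ fun b => (U b)⁻¹) f) x) =
      siteLap (fun μ => shiftEquiv (Pd := Pd) μ) (fun μ y => U (y, μ)) η (fun y => φ (WL2.equiv ℂ _ W f y)) x := by
  rw [covLaplaceSiteK, LinearMap.comp_apply, phi_covDivL2K, siteLap, pow_two, mul_smul]
  congr 1
  rw [Finset.smul_sum]
  refine Finset.sum_congr rfl fun μ _ => ?_
  -- `covDstar` of the bond function `y ↦ φ((D f)(y, μ)) = η⁻¹ covD … (φ∘f) y`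
  have hfun : (fun y => φ (WL2.equiv ℂ _ W (covDerivL2K ℂ c₀ ((η : ℂ))⁻¹ (adTransportW φ U) f) (y, μ))) =
      fun y => ((η : ℂ))⁻¹ • covD (fun μ => shiftEquiv (Pd := Pd) μ) (fun μ y => U (y, μ)) μ (fun y => φ (WL2.equiv ℂ _ W f y)) y :=
    funext fun y => phi_covDerivL2K φ η U f y μ
  rw [hfun]
  simp only [covDstar, R, smul_sub, mul_smul_comm, smul_mul_assoc]

end Literature.MathematicalPhysics.QuantumFieldTheory.Balaban1983to89.B9Eq323SiteLaplacianJunction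

end
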